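import Literature.Analysis.Fourier.SincSmooth
import Literature.Analysis.Fourier.SinSqMultiplier
import Literature.Analysis.Fourier.TruncatedLaplaceIntegrals
import Literature.Analysis.FunctionSpaces.GaussianSchwartz
import HarnessLib

/-!
# The entire-in-`r` pieces `Φ_{k,j}` of `F_{2,high}` (CKMRV (5.3))

Cohn–Kumar–Miller–Radchenko–Viazovska, arXiv:1902.05438, §5.1 (5.3):
`F_{2,high}(τ,r) = (4 sin²(πr²/2)/π) Σ_{k=−1}^{0} e^{−pπ(2k+r²)} [𝒢_{k,0}(τ)/(2k+r²)
  + i(1 + pπ(2k+r²)) 𝒢_{k,1}(τ)/(π(2k+r²)²)]`, "holomorphic for all `r ∈ ℂ`, since the possible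
singularities at `r² = −2k` are compensated for by the vanishing of `sin²(πr²/2)`", and
"all of its `r`-derivatives have Gaussian decay".

PROVED here (real `r`): with `u = r² + 2k` one has `4 sin²(πr²/2) = π²u² sinc²(πu/2)`, so the two
shapes occurring in (5.3),
`Φ_{k,0}(r) = 4 sin²(πr²/2) e^{−πpu}/(πu) = πu·sinc²(πu/2)·e^{−πpu}` and
`Φ_{k,1}(r) = 4i sin²(πr²/2) e^{−πpu}(1+πpu)/(πu)² = i·sinc²(πu/2)(1+πpu)·e^{−πpu}`,
are (temperate function) × (Gaussian), hence SCHWARTZ functions of `r` (`phiHigh0`, `phiHigh1`, for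
`p > 0`), given by the printed closed forms wherever `u ≠ 0` (`phiHigh0_eq`, `phiHigh1_eq`) and equal to
`4 sin²(πr²/2) ∫_p^∞ (it)^j e^{−2πkt} e^{−πr²t} dt` wherever `u > 0` (`phiHigh0_eq_integral`,
`phiHigh1_eq_integral`, from (5.4)).

## References

* H. Cohn, A. Kumar, S. D. Miller, D. Radchenko, M. Viazovska, Ann. of Math. 196 (2022),
  arXiv:1902.05438, §5.1 (5.3), (5.4). [CohnEtAl2019]
-/

noncomputable section

open scoped SchwartzMap Topology ContDiff
open Filter Complex MeasureTheory Set Real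

namespace Literature.Analysis.Fourier

/-! ## `u = r² + 2k` and the temperate multipliers -/

/-- `u_k(r) = r² + 2k`. [cite: CohnEtAl2019, §5.1 (5.3)] -/
def uShift (k : ℤ) (r : ℝ) : ℝ := r ^ 2 + 2 * k

/-- `hasTemperateGrowth_uShift` (auxiliary). [folklore] -/
theorem hasTemperateGrowth_uShift (k : ℤ) : Function.HasTemperateGrowth (uShift k) := by
  have h1 : Function.HasTemperateGrowth fun r : ℝ => r ^ 2 := by
    have h := Function.hasTemperateGrowth_norm_sq ℝ
    have he : (fun x : ℝ => ‖x‖ ^ 2) = fun r : ℝ => r ^ 2 := funext fun r => by rw [Real.norm_eq_abs, sq_abs]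
    rw [he] at h; exact h
  have h2 := h1.add (Function.HasTemperateGrowth.const (2 * (k : ℝ)))
  exact h2

/-- `hasTemperateGrowth_sincSq_uShift` (auxiliary): `r ↦ sinc²(πu/2)` has temperate growth. [folklore] -/
theorem hasTemperateGrowth_sincSq_uShift (k : ℤ) :
    Function.HasTemperateGrowth fun r : ℝ => Real.sinc (π * uShift k r / 2) ^ 2 := by
  have harg : Function.HasTemperateGrowth fun r : ℝ => π * uShift k r / 2 := by
    have h := ((Function.HasTemperateGrowth.const (π / 2)).mul (hasTemperateGrowth_uShift k))
    have he : (fun r : ℝ => π * uShift k r / 2) = fun r => π / 2 * uShift k r := funext fun r => by ring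
    rw [he]; exact h
  exact ((hasTemperateGrowth_sinc.comp harg)).pow 2

/-- The real multiplier of `Φ_{k,0}`: `πu sinc²(πu/2) e^{−2πpk}`. [cite: CohnEtAl2019, §5.1 (5.3)] -/
def mult0R (k : ℤ) (p r : ℝ) : ℝ := π * uShift k r * Real.sinc (π * uShift k r / 2) ^ 2 * Real.exp (-2 * π * p * k)

/-- The real multiplier of `Φ_{k,1}`: `sinc²(πu/2)(1+πpu) e^{−2πpk}`. [cite: CohnEtAl2019, §5.1 (5.3)] -/
def mult1R (k : ℤ) (p r : ℝ) : ℝ := Real.sinc (π * uShift k r / 2) ^ 2 * (1 + π * p * uShift k r) * Real.exp (-2 * π * p * k)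

/-- `hasTemperateGrowth_mult0R` (auxiliary). [folklore] -/
theorem hasTemperateGrowth_mult0R (k : ℤ) (p : ℝ) : Function.HasTemperateGrowth (mult0R k p) := by
  unfold mult0R
  exact ((((Function.HasTemperateGrowth.const π).mul (hasTemperateGrowth_uShift k)).mul
    (hasTemperateGrowth_sincSq_uShift k)).mul (Function.HasTemperateGrowth.const _))

/-- `hasTemperateGrowth_mult1R` (auxiliary). [folklore] -/
theorem hasTemperateGrowth_mult1R (k : ℤ) (p : ℝ) : Function.HasTemperateGrowth (mult1R k p) := by
  unfold mult1R
  exact (((hasTemperateGrowth_sincSq_uShift k).mul ((Function.HasTemperateGrowth.const 1).add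
    ((Function.HasTemperateGrowth.const (π * p)).mul (hasTemperateGrowth_uShift k)))).mul
    (Function.HasTemperateGrowth.const _))

/-- Complex versions of the multipliers. [cite: CohnEtAl2019, §5.1 (5.3)] -/
def mult0 (k : ℤ) (p : ℝ) (r : ℝ) : ℂ := (mult0R k p r : ℂ)

/-- `mult1` (auxiliary). [cite: CohnEtAl2019, §5.1 (5.3)] -/
def mult1 (k : ℤ) (p : ℝ) (r : ℝ) : ℂ := I * (mult1R k p r : ℂ)

/-- `hasTemperateGrowth_mult0` (auxiliary). [folklore] -/
theorem hasTemperateGrowth_mult0 (k : ℤ) (p : ℝ) : Function.HasTemperateGrowth (mult0 k p) :=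
  (Complex.ofRealCLM.hasTemperateGrowth).comp (hasTemperateGrowth_mult0R k p)

/-- `hasTemperateGrowth_mult1` (auxiliary). [folklore] -/
theorem hasTemperateGrowth_mult1 (k : ℤ) (p : ℝ) : Function.HasTemperateGrowth (mult1 k p) :=
  (Function.HasTemperateGrowth.const I).mul ((Complex.ofRealCLM.hasTemperateGrowth).comp (hasTemperateGrowth_mult1R k p))

/-! ## The Schwartz functions `Φ_{k,0}`, `Φ_{k,1}` -/

/-- **`Φ_{k,0}(r) = πu sinc²(πu/2) e^{−πpu}` as a Schwartz function of `r`** (`p > 0`).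
[cite: CohnEtAl2019, §5.1 (5.3)] -/
def phiHigh0 (k : ℤ) (p : ℝ) : 𝓢(ℝ, ℂ) :=
  SchwartzMap.smulLeftCLM ℂ (mult0 k p) (Literature.Analysis.FunctionSpaces.gaussianSchwartz ℝ (π * p))

/-- **`Φ_{k,1}(r) = i sinc²(πu/2)(1+πpu) e^{−πpu}` as a Schwartz function of `r`** (`p > 0`).
[cite: CohnEtAl2019, §5.1 (5.3)] -/
def phiHigh1 (k : ℤ) (p : ℝ) : 𝓢(ℝ, ℂ) :=
  SchwartzMap.smulLeftCLM ℂ (mult1 k p) (Literature.Analysis.FunctionSpaces.gaussianSchwartz ℝ (π * p))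

/-- `phiHigh0_apply` (auxiliary). [cite: CohnEtAl2019, §5.1 (5.3)] -/
theorem phiHigh0_apply (k : ℤ) {p : ℝ} (hp : 0 < p) (r : ℝ) :
    phiHigh0 k p r = mult0 k p r * (Real.exp (-(π * p) * r ^ 2) : ℝ) := by
  rw [phiHigh0, SchwartzMap.smulLeftCLM_apply (hasTemperateGrowth_mult0 k p)]
  dsimp only
  rw [Literature.Analysis.FunctionSpaces.gaussianSchwartz_apply (mul_pos Real.pi_pos hp), smul_eq_mul,
    Real.norm_eq_abs, sq_abs]

/-- `phiHigh1_apply` (auxiliary). [cite: CohnEtAl2019, §5.1 (5.3)] -/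
theorem phiHigh1_apply (k : ℤ) {p : ℝ} (hp : 0 < p) (r : ℝ) :
    phiHigh1 k p r = mult1 k p r * (Real.exp (-(π * p) * r ^ 2) : ℝ) := by
  rw [phiHigh1, SchwartzMap.smulLeftCLM_apply (hasTemperateGrowth_mult1 k p)]
  dsimp only
  rw [Literature.Analysis.FunctionSpaces.gaussianSchwartz_apply (mul_pos Real.pi_pos hp), smul_eq_mul,
    Real.norm_eq_abs, sq_abs]

/-! ## The trigonometric identity `4 sin²(πr²/2) = π²u² sinc²(πu/2)` -/

/-- `sin x = x · sinc x`. [folklore] -/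
theorem sin_eq_mul_sinc (x : ℝ) : Real.sin x = x * Real.sinc x := by
  by_cases hx : x = 0
  · subst hx; simp
  · rw [Real.sinc_of_ne_zero hx]; field_simp

/-- **`4 sin²(πr²/2) = π²u² sinc²(πu/2)`**, `u = r² + 2k`. [cite: CohnEtAl2019, §5.1] -/
theorem fourSinSq_eq_sincSq (k : ℤ) (r : ℝ) :
    fourSinSq r = ((π ^ 2 * uShift k r ^ 2 * Real.sinc (π * uShift k r / 2) ^ 2 : ℝ) : ℂ) := by
  -- `4 sin²(πr²/2) = 2 − 2cos(πr²) = 2 − 2cos(πu − 2πk) = 4 sin²(πu/2) = (πu)² sinc²(πu/2)`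
  have h1 : (4 * Real.sin (π * r ^ 2 / 2) ^ 2 : ℝ) = 4 * Real.sin (π * uShift k r / 2) ^ 2 := by
    have e1 : 4 * Real.sin (π * r ^ 2 / 2) ^ 2 = 2 - 2 * Real.cos (π * r ^ 2) := by
      have B := Real.sin_sq_add_cos_sq (π * r ^ 2 / 2)
      have C := Real.cos_two_mul (π * r ^ 2 / 2)
      rw [show 2 * (π * r ^ 2 / 2) = π * r ^ 2 by ring] at C
      linear_combination 4 * B + 2 * C
    have e2 : 4 * Real.sin (π * uShift k r / 2) ^ 2 = 2 - 2 * Real.cos (π * uShift k r) := by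
      have B := Real.sin_sq_add_cos_sq (π * uShift k r / 2)
      have C := Real.cos_two_mul (π * uShift k r / 2)
      rw [show 2 * (π * uShift k r / 2) = π * uShift k r by ring] at C
      linear_combination 4 * B + 2 * C
    have e3 : Real.cos (π * uShift k r) = Real.cos (π * r ^ 2) := by
      rw [uShift, show π * (r ^ 2 + 2 * k) = π * r ^ 2 + k * (2 * π) by ring, Real.cos_add_int_mul_two_pi]
    rw [e1, e2, e3]
  have h2 : Real.sin (π * uShift k r / 2) = π * uShift k r / 2 * Real.sinc (π * uShift k r / 2) := sin_eq_mul_sinc _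
  rw [fourSinSq, h1, h2]
  push_cast
  ring

/-! ## Closed forms (5.3) where `u ≠ 0` -/

/-- **`Φ_{k,0}(r) = 4 sin²(πr²/2)·e^{−πpu}/(πu)`** for `u = r² + 2k ≠ 0`. [cite: CohnEtAl2019, §5.1 (5.3)] -/
theorem phiHigh0_eq (k : ℤ) {p : ℝ} (hp : 0 < p) {r : ℝ} (hu : uShift k r ≠ 0) :
    phiHigh0 k p r = fourSinSq r * ((Real.exp (-π * p * uShift k r) / (π * uShift k r) : ℝ) : ℂ) := by
  rw [phiHigh0_apply k hp, fourSinSq_eq_sincSq k, mult0, mult0R]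
  have hexp : Real.exp (-π * p * uShift k r) = Real.exp (-2 * π * p * k) * Real.exp (-(π * p) * r ^ 2) := by
    rw [← Real.exp_add]; congr 1; simp only [uShift]; ring
  rw [hexp]
  have hπ : (π : ℂ) ≠ 0 := by exact_mod_cast Real.pi_ne_zero
  have hu' : (uShift k r : ℂ) ≠ 0 := by exact_mod_cast hu
  push_cast
  field_simp

/-- **`Φ_{k,1}(r) = 4i sin²(πr²/2)·e^{−πpu}(1+πpu)/(πu)²`** for `u ≠ 0`. [cite: CohnEtAl2019, §5.1 (5.3)] -/
theorem phiHigh1_eq (k : ℤ) {p : ℝ} (hp : 0 < p) {r : ℝ} (hu : uShift k r ≠ 0) :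
    phiHigh1 k p r = fourSinSq r * I *
      ((Real.exp (-π * p * uShift k r) * (1 + π * p * uShift k r) / (π * uShift k r) ^ 2 : ℝ) : ℂ) := by
  rw [phiHigh1_apply k hp, fourSinSq_eq_sincSq k, mult1, mult1R]
  have hexp : Real.exp (-π * p * uShift k r) = Real.exp (-2 * π * p * k) * Real.exp (-(π * p) * r ^ 2) := by
    rw [← Real.exp_add]; congr 1; simp only [uShift]; ring
  rw [hexp]
  have hπ : (π : ℂ) ≠ 0 := by exact_mod_cast Real.pi_ne_zero
  have hu' : (uShift k r : ℂ) ≠ 0 := by exact_mod_cast hu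
  push_cast
  field_simp

/-! ## Agreement with the truncated Laplace integrals (5.4) where `u > 0` -/

/-- **`Φ_{k,0}(r) = 4 sin²(πr²/2) ∫_p^∞ e^{−2πkt}e^{−πr²t} dt`** for `u = r² + 2k > 0`.
[cite: CohnEtAl2019, §5.1 (5.3)–(5.4)] -/
theorem phiHigh0_eq_integral (k : ℤ) {p : ℝ} (hp : 0 < p) {r : ℝ} (hu : 0 < uShift k r) :
    phiHigh0 k p r = fourSinSq r * ∫ t : ℝ in Ioi p, cexp (-2 * π * k * t) * cexp (-π * (r : ℂ) ^ 2 * t) := by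
  have h : 0 < (2 * (k : ℂ) + (r : ℂ) ^ 2).re := by
    have : (2 * (k : ℂ) + (r : ℂ) ^ 2).re = uShift k r := by simp [uShift, pow_two]; ring
    rw [this]; exact hu
  rw [integral_Ioi_gaussianLaplace h p, phiHigh0_eq k hp hu.ne']
  congr 1
  have hu2 : (2 * (k : ℂ) + (r : ℂ) ^ 2) = (uShift k r : ℂ) := by simp [uShift]; ring
  rw [hu2]
  push_cast
  rw [show -(π : ℂ) * p * (uShift k r : ℝ) = -(p : ℂ) * π * (uShift k r : ℝ) by ring]

/-- **`Φ_{k,1}(r) = 4 sin²(πr²/2) ∫_p^∞ (it) e^{−2πkt}e^{−πr²t} dt`** for `u > 0`.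
[cite: CohnEtAl2019, §5.1 (5.3)–(5.4)] -/
theorem phiHigh1_eq_integral (k : ℤ) {p : ℝ} (hp : 0 < p) {r : ℝ} (hu : 0 < uShift k r) :
    phiHigh1 k p r = fourSinSq r * ∫ t : ℝ in Ioi p, (I * t) * (cexp (-2 * π * k * t) * cexp (-π * (r : ℂ) ^ 2 * t)) := by
  have h : 0 < (2 * (k : ℂ) + (r : ℂ) ^ 2).re := by
    have : (2 * (k : ℂ) + (r : ℂ) ^ 2).re = uShift k r := by simp [uShift, pow_two]; ring
    rw [this]; exact hu
  rw [integral_Ioi_mul_gaussianLaplace h p, phiHigh1_eq k hp hu.ne']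
  have hu2 : (2 * (k : ℂ) + (r : ℂ) ^ 2) = (uShift k r : ℂ) := by simp [uShift]; ring
  rw [hu2, mul_assoc]
  congr 1
  have hπ : (π : ℂ) ≠ 0 := by exact_mod_cast Real.pi_ne_zero
  have hu' : (uShift k r : ℂ) ≠ 0 := by exact_mod_cast hu.ne'
  push_cast
  rw [show -(π : ℂ) * p * (uShift k r : ℝ) = -(p : ℂ) * π * (uShift k r : ℝ) by ring]
  field_simp

end Literature.Analysis.Fourier
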